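import Summits.QuantumFields.GaugeBoot.ZdLoopEquationManySpectators
import Summits.QuantumFields.GaugeBoot.ZdLoopEquationStates
import HarnessLib

/-!
# The MULTI-TRACE loop equation (any number of spectator loops) holds for every Haar-shift state on `ℤ^d`: DLR states, infinite-volume limit points (gauge-boot, `ℤ^d` loop equations 6/6)

HONEST FRAMING (cell `pub-gaugeboot`, page 1 of every file): the venture produces certified bounds
on lattice expectations at stated coupling, gauge group, dimension and torus size; NOT a mass gap,
NOT a continuum limit, NOT a string tension; NOT Yang–Mills-summit-bearing (barriers
`FixedCouplingUltralocality`, `PerturbativeInvisibility`).  This file enters no number: it proves that the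
multi-trace rows of the finite-`N` bootstrap on the infinite lattice are exact identities of every DLR state.

## Content

Assembly of the many-spectator pair identity of `ZdLoopEquationManySpectators` over the matrix units
`E_ij − (s/N)δ_ij` for a finite measure `μ` on `LGConfig d G`:

* ★★★ `loopEquationZdMany_of_sdPairMany` — for `w` closed at `x`, spectators `(x_a, v_a)_{a∈ι}` on `ℤ^d`:
  `Σ_k E_μ[splitTerm_k(w)·Π_a tr hol v_a] + Σ_a Σ_{k'} E_μ[(Π_{b≠a} tr hol v_b)·mergeTerm_{k'}(w, v_a)]
   + (β/2)·Σ_{ν≠μ,ε} E_μ[plaqTerm_{ν,ε}(w)·Π_a tr hol v_a] = 0`;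
* `sdPairManyZd_specialUnitaryGroup` / `_unitaryGroup` — admissibility for Haar-shift states;
* ★★★ `IsHaarShiftState.loopEquationMany_suN` / `_uN` — EVERY Haar-shift state of `SU(N)` / `U(N)` lattice
  Yang–Mills on `ℤ^d` satisfies every multi-trace Makeenko–Migdal equation (Kazakov–Zheng 2024 §2.3, the rows
  "variation of `W[C]_{ab} Π_i W[C_i]`" of the finite-`N` bootstrap), at every real `β`;
* ★★★ `loopEquationMany_suN_of_mem_ymGibbsMeasures` / `_uN_…` — hence every infinite-volume DLR state
  `μ ∈ 𝒢(β)`, and (`loopEquationMany_suN_of_mem_infiniteVolumeLimitPoints`) every weak limit point of the torus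
  Wilson states: the multi-trace rows Kazakov–Zheng impose on `ℤ^d` are SOUND for all of them — with
  `ZdLoopEquationStates` (single-trace rows) and `loopGram` positivity, every constraint of the finite-`N`
  bootstrap on the infinite lattice is now a theorem about every DLR state.

References: V. Kazakov, Z. Zheng, arXiv:2404.16925 §2.3; P. Anderson, M. Kruczenski, Nucl. Phys. B 921 (2017);
S. Chatterjee, Comm. Math. Phys. 366 (2019) Thm. 8.1; H.-O. Georgii, *Gibbs Measures and Phase Transitions*
(2011) Def. 2.9.  Everything is `[folklore]`.
-/

noncomputable section

open MeasureTheory Filter Topology NormedSpace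
open scoped Matrix.Norms.Frobenius Matrix
open Literature.Probability.LatticeModels (Site IsGibbsMeasure)
open Literature.MathematicalPhysics.QuantumLattice (LGConfig ZdEdge IsCylinder fundamentalRep unitaryFundamentalRep
  fundamentalLatticeRep unitaryFundamentalLatticeRep continuous_fundamentalRep continuous_unitaryFundamentalRep
  mem_oneParamGenerators_specialUnitaryGroup mem_oneParamGenerators_unitaryGroup ymGibbsMeasures ymSpecification
  infiniteVolumeLimitPoints mem_ymGibbsMeasures_of_mem_infiniteVolumeLimitPoints_holds)
open Literature.MathematicalPhysics.QuantumFieldTheory (LatticeRep)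

namespace Summit.QuantumFields.GaugeBoot

namespace TiltedRP

variable {d N : ℕ} {G : Type} [Group G] [TopologicalSpace G] [IsTopologicalGroup G] [CompactSpace G]
  [MeasurableSpace G] [BorelSpace G] {ι : Type} [Fintype ι] [DecidableEq ι]
  (μW : Measure (LGConfig d G)) [IsFiniteMeasure μW] (r : LatticeRep G)

/-! ### The abstract multi-trace loop equation of a state on `ℤ^d` -/

/-- ★★★ **THE SINGLE-LINK LOOP EQUATION WITH A FINITE FAMILY OF SPECTATOR LOOPS, FOR A STATE ON `ℤ^d`
(abstract form).**  Let `G` be compact with lattice representation `r`, `μ` a finite measure on `LGConfig d G`,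
`β` real, `(x, a)` a link, `w` a word CLOSED at `x`, `(v_c)_{c∈ι}` spectator words from `x_c`, and `s ∈ ℂ` a
weight such that every direction `X_ij = E_ij − (s/N)δ_ij·1` satisfies `SDPairManyZd μ`.  Then
`Σ_k E[splitTerm_k(w)·Π_c tr hol v_c] + Σ_c Σ_{k'} E[(Π_{b≠c} tr hol v_b)·mergeTerm_{k'}(w, v_c)]
 + (β/2)·Σ_{ν≠a} Σ_ε E[plaqTerm_{ν,ε}(w)·Π_c tr hol v_c] = 0`. [folklore] -/
theorem loopEquationZdMany_of_sdPairMany (β : ℝ) (x : Site d) (a : Fin d) (s : ℂ) (w : Word d)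
    (hw : Word.endpoint (zdUnit d) x w = x) (xs : ι → Site d) (vs : ι → Word d)
    (hP : ∀ i j : Fin r.N, SDPairManyZd μW r β x a x w xs vs (unitDir s i j)) :
    (∑ k ∈ Finset.range w.length, ∫ U, splitTerm r.ρ (zdUnit d) s x a U w k *
        (∏ c, (r.ρ (wordHolonomy (zdUnit d) U (xs c) (vs c))).trace) ∂μW) +
      (∑ c, ∑ k ∈ Finset.range (vs c).length,
        ∫ U, (∏ b ∈ Finset.univ.erase c, (r.ρ (wordHolonomy (zdUnit d) U (xs b) (vs b))).trace) *
          mergeTerm r.ρ (zdUnit d) s x a U w (xs c) (vs c) k ∂μW) +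
      (β / 2 : ℂ) * ∑ ν ∈ Finset.univ.erase a, ∑ ε : Bool,
        ∫ U, plaqTerm r.ρ (zdUnit d) s x a U w ν ε * (∏ c, (r.ρ (wordHolonomy (zdUnit d) U (xs c) (vs c))).trace) ∂μW = 0 := by
  have hcP : Continuous fun U : LGConfig d G => ∏ c, (r.ρ (wordHolonomy (zdUnit d) U (xs c) (vs c))).trace :=
    continuous_finsetProd _ fun c _ => continuous_trace_wordHolonomy (zdUnit d) r (xs c) (vs c)
  have hcPe : ∀ c, Continuous fun U : LGConfig d G =>
      ∏ b ∈ Finset.univ.erase c, (r.ρ (wordHolonomy (zdUnit d) U (xs b) (vs b))).trace :=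
    fun c => continuous_finsetProd _ fun b _ => continuous_trace_wordHolonomy (zdUnit d) r (xs b) (vs b)
  have hf : ∀ i j : Fin r.N, Integrable (fun U =>
      (Matrix.single j i (1 : ℂ) * insDeriv r.ρ (zdUnit d) (x, a) (unitDir s i j) U x w).trace *
          (∏ c, (r.ρ (wordHolonomy (zdUnit d) U (xs c) (vs c))).trace) +
        (Matrix.single j i (1 : ℂ) * r.ρ (wordHolonomy (zdUnit d) U x w)).trace *
          ∑ c, (∏ b ∈ Finset.univ.erase c, (r.ρ (wordHolonomy (zdUnit d) U (xs b) (vs b))).trace) *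
            (insDeriv r.ρ (zdUnit d) (x, a) (unitDir s i j) U (xs c) (vs c)).trace) μW :=
    fun i j => integrable_of_continuous_zd r μW (continuous_lhsMany (zdUnit d) r _ _ x a x w xs vs _)
  have hg' : ∀ i j : Fin r.N, Integrable (fun U => (Matrix.single j i (1 : ℂ) * r.ρ (wordHolonomy (zdUnit d) U x w)).trace *
      (∏ c, (r.ρ (wordHolonomy (zdUnit d) U (xs c) (vs c))).trace) * (-(1 / 2) * plaqIns r.ρ (zdUnit d) (unitDir s i j) U x a)) μW :=
    fun i j => integrable_of_continuous_zd r μW (continuous_rhsMany (zdUnit d) r _ _ x a x w xs vs)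
  -- pointwise: the contracted left side
  have hL : ∀ U : LGConfig d G, ∑ i : Fin r.N, ∑ j : Fin r.N,
      ((Matrix.single j i (1 : ℂ) * insDeriv r.ρ (zdUnit d) (x, a) (unitDir s i j) U x w).trace *
          (∏ c, (r.ρ (wordHolonomy (zdUnit d) U (xs c) (vs c))).trace) +
        (Matrix.single j i (1 : ℂ) * r.ρ (wordHolonomy (zdUnit d) U x w)).trace *
          ∑ c, (∏ b ∈ Finset.univ.erase c, (r.ρ (wordHolonomy (zdUnit d) U (xs b) (vs b))).trace) *
            (insDeriv r.ρ (zdUnit d) (x, a) (unitDir s i j) U (xs c) (vs c)).trace) =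
      (∑ k ∈ Finset.range w.length, splitTerm r.ρ (zdUnit d) s x a U w k) *
          (∏ c, (r.ρ (wordHolonomy (zdUnit d) U (xs c) (vs c))).trace) +
        ∑ c, (∏ b ∈ Finset.univ.erase c, (r.ρ (wordHolonomy (zdUnit d) U (xs b) (vs b))).trace) *
          ∑ k ∈ Finset.range (vs c).length, mergeTerm r.ρ (zdUnit d) s x a U w (xs c) (vs c) k := by
    intro U
    rw [← sum_trace_insDeriv_unitDir (zdUnit d) s x a U w, ← sum_trace_mul_sum_prod_insDeriv_unitDir (zdUnit d) s x a U w xs vs]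
    simp only [Finset.sum_mul, ← Finset.sum_add_distrib]
  -- pointwise: the contracted right side
  have hR : ∀ U : LGConfig d G, ∑ i : Fin r.N, ∑ j : Fin r.N,
      (Matrix.single j i (1 : ℂ) * r.ρ (wordHolonomy (zdUnit d) U x w)).trace *
        (∏ c, (r.ρ (wordHolonomy (zdUnit d) U (xs c) (vs c))).trace) * (-(1 / 2) * plaqIns r.ρ (zdUnit d) (unitDir s i j) U x a) =
      (-(1 / 2) * ∑ ν ∈ Finset.univ.erase a, ∑ ε : Bool, plaqTerm r.ρ (zdUnit d) s x a U w ν ε) *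
        (∏ c, (r.ρ (wordHolonomy (zdUnit d) U (xs c) (vs c))).trace) := by
    intro U
    rw [← sum_trace_mul_plaqIns_unitDir (zdUnit d) s x a U w hw, Finset.sum_mul]
    refine Finset.sum_congr rfl fun i _ => ?_
    rw [Finset.sum_mul]
    exact Finset.sum_congr rfl fun j _ => by ring
  -- integrate the contracted identity
  have hsum : ∫ U, ((∑ k ∈ Finset.range w.length, splitTerm r.ρ (zdUnit d) s x a U w k) *
        (∏ c, (r.ρ (wordHolonomy (zdUnit d) U (xs c) (vs c))).trace) +
      ∑ c, (∏ b ∈ Finset.univ.erase c, (r.ρ (wordHolonomy (zdUnit d) U (xs b) (vs b))).trace) *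
        ∑ k ∈ Finset.range (vs c).length, mergeTerm r.ρ (zdUnit d) s x a U w (xs c) (vs c) k) ∂μW =
      (β : ℂ) * ∫ U, (-(1 / 2) * ∑ ν ∈ Finset.univ.erase a, ∑ ε : Bool, plaqTerm r.ρ (zdUnit d) s x a U w ν ε) *
        (∏ c, (r.ρ (wordHolonomy (zdUnit d) U (xs c) (vs c))).trace) ∂μW := by
    calc ∫ U, ((∑ k ∈ Finset.range w.length, splitTerm r.ρ (zdUnit d) s x a U w k) *
          (∏ c, (r.ρ (wordHolonomy (zdUnit d) U (xs c) (vs c))).trace) +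
        ∑ c, (∏ b ∈ Finset.univ.erase c, (r.ρ (wordHolonomy (zdUnit d) U (xs b) (vs b))).trace) *
          ∑ k ∈ Finset.range (vs c).length, mergeTerm r.ρ (zdUnit d) s x a U w (xs c) (vs c) k) ∂μW
        = ∫ U, ∑ i : Fin r.N, ∑ j : Fin r.N,
            ((Matrix.single j i (1 : ℂ) * insDeriv r.ρ (zdUnit d) (x, a) (unitDir s i j) U x w).trace *
                (∏ c, (r.ρ (wordHolonomy (zdUnit d) U (xs c) (vs c))).trace) +
              (Matrix.single j i (1 : ℂ) * r.ρ (wordHolonomy (zdUnit d) U x w)).trace *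
                ∑ c, (∏ b ∈ Finset.univ.erase c, (r.ρ (wordHolonomy (zdUnit d) U (xs b) (vs b))).trace) *
                  (insDeriv r.ρ (zdUnit d) (x, a) (unitDir s i j) U (xs c) (vs c)).trace) ∂μW :=
          integral_congr_ae (ae_of_all _ fun U => (hL U).symm)
      _ = ∑ i : Fin r.N, ∑ j : Fin r.N, ∫ U,
            ((Matrix.single j i (1 : ℂ) * insDeriv r.ρ (zdUnit d) (x, a) (unitDir s i j) U x w).trace *
                (∏ c, (r.ρ (wordHolonomy (zdUnit d) U (xs c) (vs c))).trace) +
              (Matrix.single j i (1 : ℂ) * r.ρ (wordHolonomy (zdUnit d) U x w)).trace *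
                ∑ c, (∏ b ∈ Finset.univ.erase c, (r.ρ (wordHolonomy (zdUnit d) U (xs b) (vs b))).trace) *
                  (insDeriv r.ρ (zdUnit d) (x, a) (unitDir s i j) U (xs c) (vs c)).trace) ∂μW := by
          rw [integral_finsetSum _ fun i _ => integrable_finsetSum _ fun j _ => hf i j]
          exact Finset.sum_congr rfl fun i _ => integral_finsetSum _ fun j _ => hf i j
      _ = ∑ i : Fin r.N, ∑ j : Fin r.N, (β : ℂ) * ∫ U, (Matrix.single j i (1 : ℂ) * r.ρ (wordHolonomy (zdUnit d) U x w)).trace *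
            (∏ c, (r.ρ (wordHolonomy (zdUnit d) U (xs c) (vs c))).trace) * (-(1 / 2) * plaqIns r.ρ (zdUnit d) (unitDir s i j) U x a) ∂μW :=
          Finset.sum_congr rfl fun i _ => Finset.sum_congr rfl fun j _ => hP i j (Matrix.single j i 1)
      _ = (β : ℂ) * ∑ i : Fin r.N, ∑ j : Fin r.N, ∫ U, (Matrix.single j i (1 : ℂ) * r.ρ (wordHolonomy (zdUnit d) U x w)).trace *
            (∏ c, (r.ρ (wordHolonomy (zdUnit d) U (xs c) (vs c))).trace) * (-(1 / 2) * plaqIns r.ρ (zdUnit d) (unitDir s i j) U x a) ∂μW := by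
          simp only [Finset.mul_sum]
      _ = (β : ℂ) * ∫ U, ∑ i : Fin r.N, ∑ j : Fin r.N, (Matrix.single j i (1 : ℂ) * r.ρ (wordHolonomy (zdUnit d) U x w)).trace *
            (∏ c, (r.ρ (wordHolonomy (zdUnit d) U (xs c) (vs c))).trace) * (-(1 / 2) * plaqIns r.ρ (zdUnit d) (unitDir s i j) U x a) ∂μW := by
          rw [integral_finsetSum _ fun i _ => integrable_finsetSum _ fun j _ => hg' i j]
          congr 1
          exact (Finset.sum_congr rfl fun i _ => integral_finsetSum _ fun j _ => hg' i j).symm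
      _ = (β : ℂ) * ∫ U, (-(1 / 2) * ∑ ν ∈ Finset.univ.erase a, ∑ ε : Bool, plaqTerm r.ρ (zdUnit d) s x a U w ν ε) *
            (∏ c, (r.ρ (wordHolonomy (zdUnit d) U (xs c) (vs c))).trace) ∂μW := by
          congr 1
          exact integral_congr_ae (ae_of_all _ fun U => hR U)
  -- split the integrals into the stated sums
  have hi1 : ∀ k, Integrable (fun U => splitTerm r.ρ (zdUnit d) s x a U w k *
      (∏ c, (r.ρ (wordHolonomy (zdUnit d) U (xs c) (vs c))).trace)) μW :=
    fun k => integrable_of_continuous_zd r μW ((continuous_splitTerm (zdUnit d) r s x a w k).mul hcP)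
  have hi2 : ∀ c k, Integrable (fun U => (∏ b ∈ Finset.univ.erase c, (r.ρ (wordHolonomy (zdUnit d) U (xs b) (vs b))).trace) *
      mergeTerm r.ρ (zdUnit d) s x a U w (xs c) (vs c) k) μW :=
    fun c k => integrable_of_continuous_zd r μW ((hcPe c).mul (continuous_mergeTerm (zdUnit d) r s x a w (xs c) (vs c) k))
  have hi3 : ∀ ν ε, Integrable (fun U => plaqTerm r.ρ (zdUnit d) s x a U w ν ε *
      (∏ c, (r.ρ (wordHolonomy (zdUnit d) U (xs c) (vs c))).trace)) μW :=
    fun ν ε => integrable_of_continuous_zd r μW ((continuous_plaqTerm (zdUnit d) r s x a w ν ε).mul hcP)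
  have e2 : ∀ U : LGConfig d G,
      ∑ c, (∏ b ∈ Finset.univ.erase c, (r.ρ (wordHolonomy (zdUnit d) U (xs b) (vs b))).trace) *
        ∑ k ∈ Finset.range (vs c).length, mergeTerm r.ρ (zdUnit d) s x a U w (xs c) (vs c) k =
      ∑ c, ∑ k ∈ Finset.range (vs c).length,
        (∏ b ∈ Finset.univ.erase c, (r.ρ (wordHolonomy (zdUnit d) U (xs b) (vs b))).trace) *
          mergeTerm r.ρ (zdUnit d) s x a U w (xs c) (vs c) k := fun U =>
    Finset.sum_congr rfl fun c _ => Finset.mul_sum _ _ _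
  have h1 : ∫ U, ((∑ k ∈ Finset.range w.length, splitTerm r.ρ (zdUnit d) s x a U w k) *
        (∏ c, (r.ρ (wordHolonomy (zdUnit d) U (xs c) (vs c))).trace) +
      ∑ c, (∏ b ∈ Finset.univ.erase c, (r.ρ (wordHolonomy (zdUnit d) U (xs b) (vs b))).trace) *
        ∑ k ∈ Finset.range (vs c).length, mergeTerm r.ρ (zdUnit d) s x a U w (xs c) (vs c) k) ∂μW =
      (∑ k ∈ Finset.range w.length, ∫ U, splitTerm r.ρ (zdUnit d) s x a U w k *
        (∏ c, (r.ρ (wordHolonomy (zdUnit d) U (xs c) (vs c))).trace) ∂μW) +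
      ∑ c, ∑ k ∈ Finset.range (vs c).length,
        ∫ U, (∏ b ∈ Finset.univ.erase c, (r.ρ (wordHolonomy (zdUnit d) U (xs b) (vs b))).trace) *
          mergeTerm r.ρ (zdUnit d) s x a U w (xs c) (vs c) k ∂μW := by
    simp_rw [e2, Finset.sum_mul]
    rw [integral_add (integrable_finsetSum _ fun k _ => hi1 k)
      (integrable_finsetSum _ fun c _ => integrable_finsetSum _ fun k _ => hi2 c k),
      integral_finsetSum _ fun k _ => hi1 k,
      integral_finsetSum _ fun c _ => integrable_finsetSum _ fun k _ => hi2 c k]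
    congr 1
    exact Finset.sum_congr rfl fun c _ => integral_finsetSum _ fun k _ => hi2 c k
  have h2 : ∫ U, (-(1 / 2) * ∑ ν ∈ Finset.univ.erase a, ∑ ε : Bool, plaqTerm r.ρ (zdUnit d) s x a U w ν ε) *
      (∏ c, (r.ρ (wordHolonomy (zdUnit d) U (xs c) (vs c))).trace) ∂μW =
      -(1 / 2) * ∑ ν ∈ Finset.univ.erase a, ∑ ε : Bool,
        ∫ U, plaqTerm r.ρ (zdUnit d) s x a U w ν ε * (∏ c, (r.ρ (wordHolonomy (zdUnit d) U (xs c) (vs c))).trace) ∂μW := by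
    have : ∀ U : LGConfig d G, (-(1 / 2) * ∑ ν ∈ Finset.univ.erase a, ∑ ε : Bool, plaqTerm r.ρ (zdUnit d) s x a U w ν ε) *
        (∏ c, (r.ρ (wordHolonomy (zdUnit d) U (xs c) (vs c))).trace) = -(1 / 2) * ∑ ν ∈ Finset.univ.erase a, ∑ ε : Bool,
          plaqTerm r.ρ (zdUnit d) s x a U w ν ε * (∏ c, (r.ρ (wordHolonomy (zdUnit d) U (xs c) (vs c))).trace) := fun U => by
      rw [mul_assoc, Finset.sum_mul]
      congr 1
      exact Finset.sum_congr rfl fun ν _ => Finset.sum_mul _ _ _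
    simp_rw [this]
    rw [integral_const_mul]
    congr 1
    rw [integral_finsetSum _ fun ν _ => integrable_finsetSum _ fun ε _ => hi3 ν ε]
    exact Finset.sum_congr rfl fun ν _ => integral_finsetSum _ fun ε _ => hi3 ν ε
  rw [h1, h2] at hsum
  linear_combination hsum

variable {μW}

/-! ### `SU(N)` and `U(N)`: admissibility for Haar-shift states -/

/-- **`SU(N)` Haar-shift states on `ℤ^d`: every traceless direction satisfies the many-spectator pair
identity.** [folklore] -/
theorem sdPairManyZd_specialUnitaryGroup (N : ℕ) {β : ℝ}
    {μW : Measure (LGConfig d (Matrix.specialUnitaryGroup (Fin N) ℂ))} [IsFiniteMeasure μW]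
    (hμ : IsHaarShiftState (fundamentalLatticeRep N).ρ β μW) (x : Site d) (μ : Fin d) (x₀ : Site d)
    (w : Word d) (xs : ι → Site d) (vs : ι → Word d) (X : Matrix (Fin N) (Fin N) ℂ) (hX : X.trace = 0) :
    SDPairManyZd μW (fundamentalLatticeRep N) β x μ x₀ w xs vs X := by
  refine sdPairManyZd_of_traceless (fundamentalLatticeRep N) β x μ x₀ w xs vs (fun X hXs hX0 => ?_) X hX
  have hmem := mem_oneParamGenerators_specialUnitaryGroup (n := Fin N) (X := X) hXs hX0
  refine sdPairManyZd_of_oneParam (fundamentalLatticeRep N) hμ x μ x₀ w xs vs hXs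
    (k := fun t => ⟨NormedSpace.exp (t • X), hmem t⟩) (fun a b => Subtype.ext ?_) (fun t => ?_)
  · change NormedSpace.exp ((a + b) • X) = NormedSpace.exp (a • X) * NormedSpace.exp (b • X)
    rw [add_smul]
    exact Matrix.exp_add_of_commute _ _ (((Commute.refl X).smul_left a).smul_right b)
  · change NormedSpace.exp (t • X) = NormedSpace.exp ((t : ℂ) • X)
    rw [Complex.coe_smul]

/-- **`U(N)` Haar-shift states on `ℤ^d`: every direction satisfies the many-spectator pair identity.**
[folklore] -/
theorem sdPairManyZd_unitaryGroup (N : ℕ) {β : ℝ}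
    {μW : Measure (LGConfig d (Matrix.unitaryGroup (Fin N) ℂ))} [IsFiniteMeasure μW]
    (hμ : IsHaarShiftState (unitaryFundamentalLatticeRep N).ρ β μW) (x : Site d) (μ : Fin d)
    (x₀ : Site d) (w : Word d) (xs : ι → Site d) (vs : ι → Word d) (X : Matrix (Fin N) (Fin N) ℂ) :
    SDPairManyZd μW (unitaryFundamentalLatticeRep N) β x μ x₀ w xs vs X := by
  refine sdPairManyZd_of_skew (unitaryFundamentalLatticeRep N) β x μ x₀ w xs vs (fun X hXs => ?_) X
  have hmem := mem_oneParamGenerators_unitaryGroup (n := Fin N) (X := X) hXs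
  refine sdPairManyZd_of_oneParam (unitaryFundamentalLatticeRep N) hμ x μ x₀ w xs vs hXs
    (k := fun t => ⟨NormedSpace.exp (t • X), hmem t⟩) (fun a b => Subtype.ext ?_) (fun t => ?_)
  · change NormedSpace.exp ((a + b) • X) = NormedSpace.exp (a • X) * NormedSpace.exp (b • X)
    rw [add_smul]
    exact Matrix.exp_add_of_commute _ _ (((Commute.refl X).smul_left a).smul_right b)
  · change NormedSpace.exp (t • X) = NormedSpace.exp ((t : ℂ) • X)
    rw [Complex.coe_smul]


end TiltedRP

/-! ### The multi-trace loop equation for Haar-shift states, DLR states and limit points -/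

section States

variable {d N : ℕ} {ι : Type} [Fintype ι] [DecidableEq ι]

/-- ★★★ **EVERY `SU(N)` HAAR-SHIFT STATE ON `ℤ^d` SATISFIES EVERY MULTI-TRACE LOOP EQUATION** (every `N`, every
real `β`, every finite measure `μ` with the one-link Haar-shift identity of the Wilson action; `w` closed at `x`,
spectators `(x_c, v_c)_{c∈ι}`, link `(x, a)`; periodic notation with `e = zdUnit d`):
`Σ_k E[splitTerm_k(w)·Πtr hol v_c] + Σ_c Σ_{k'} E[(Π_{b≠c} tr hol v_b)·mergeTerm_{k'}(w, v_c)] + (β/2)ΣΣ E[plaqTerm(w)·Πtr hol v_c] = 0`.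
[folklore] -/
theorem IsHaarShiftState.loopEquationMany_suN {β : ℝ}
    {μ : Measure (LGConfig d (Matrix.specialUnitaryGroup (Fin N) ℂ))} [IsFiniteMeasure μ]
    (hμ : IsHaarShiftState (fundamentalRep (Fin N)) β μ) (x : Site d) (a : Fin d) (w : Word d)
    (hw : TiltedRP.Word.endpoint (TiltedRP.zdUnit d) x w = x) (xs : ι → Site d) (vs : ι → Word d) :
    (∑ k ∈ Finset.range w.length, ∫ U, TiltedRP.splitTerm (fundamentalRep (Fin N)) (TiltedRP.zdUnit d) 1 x a U w k *
        (∏ c, (fundamentalRep (Fin N) (TiltedRP.wordHolonomy (TiltedRP.zdUnit d) U (xs c) (vs c))).trace) ∂μ) +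
      (∑ c, ∑ k ∈ Finset.range (vs c).length,
        ∫ U, (∏ b ∈ Finset.univ.erase c, (fundamentalRep (Fin N) (TiltedRP.wordHolonomy (TiltedRP.zdUnit d) U (xs b) (vs b))).trace) *
          TiltedRP.mergeTerm (fundamentalRep (Fin N)) (TiltedRP.zdUnit d) 1 x a U w (xs c) (vs c) k ∂μ) +
      (β / 2 : ℂ) * ∑ ν ∈ Finset.univ.erase a, ∑ ε : Bool,
        ∫ U, TiltedRP.plaqTerm (fundamentalRep (Fin N)) (TiltedRP.zdUnit d) 1 x a U w ν ε *
          (∏ c, (fundamentalRep (Fin N) (TiltedRP.wordHolonomy (TiltedRP.zdUnit d) U (xs c) (vs c))).trace) ∂μ = 0 :=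
  TiltedRP.loopEquationZdMany_of_sdPairMany μ (fundamentalLatticeRep N) β x a 1 w hw xs vs fun i j =>
    TiltedRP.sdPairManyZd_specialUnitaryGroup N hμ x a x w xs vs _ (trace_unitDir_one i j)

/-- ★★ **Every Class-B state satisfies every multi-trace `SU(N)` loop equation** (the multi-trace rows of a Class-B
loop-equation certificate are exact for every `ω : ClassBState`; every real `β`). [folklore] -/
theorem ClassBState.loopEquationMany_suN {β : ℝ} (ω : ClassBState d (fundamentalRep (Fin N)) β) (x : Site d) (a : Fin d)
    (w : Word d) (hw : TiltedRP.Word.endpoint (TiltedRP.zdUnit d) x w = x) (xs : ι → Site d) (vs : ι → Word d) :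
    (∑ k ∈ Finset.range w.length, ∫ U, TiltedRP.splitTerm (fundamentalRep (Fin N)) (TiltedRP.zdUnit d) 1 x a U w k *
        (∏ c, (fundamentalRep (Fin N) (TiltedRP.wordHolonomy (TiltedRP.zdUnit d) U (xs c) (vs c))).trace) ∂ω.μ) +
      (∑ c, ∑ k ∈ Finset.range (vs c).length,
        ∫ U, (∏ b ∈ Finset.univ.erase c, (fundamentalRep (Fin N) (TiltedRP.wordHolonomy (TiltedRP.zdUnit d) U (xs b) (vs b))).trace) *
          TiltedRP.mergeTerm (fundamentalRep (Fin N)) (TiltedRP.zdUnit d) 1 x a U w (xs c) (vs c) k ∂ω.μ) +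
      (β / 2 : ℂ) * ∑ ν ∈ Finset.univ.erase a, ∑ ε : Bool,
        ∫ U, TiltedRP.plaqTerm (fundamentalRep (Fin N)) (TiltedRP.zdUnit d) 1 x a U w ν ε *
          (∏ c, (fundamentalRep (Fin N) (TiltedRP.wordHolonomy (TiltedRP.zdUnit d) U (xs c) (vs c))).trace) ∂ω.μ = 0 := by
  haveI := ω.isProbabilityMeasure
  exact ω.haarShift.loopEquationMany_suN x a w hw xs vs

/-- ★★★ **EVERY INFINITE-VOLUME DLR STATE `μ ∈ 𝒢(β)` OF `SU(N)` LATTICE YANG–MILLS ON `ℤ^d` SATISFIES EVERY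
MULTI-TRACE LOOP EQUATION** (every real `β`, every `d`): the multi-trace rows of Kazakov–Zheng's finite-`N`
bootstrap on the infinite lattice are sound for all DLR states. [folklore] -/
theorem loopEquationMany_suN_of_mem_ymGibbsMeasures {β : ℝ}
    {μ : Measure (LGConfig d (Matrix.specialUnitaryGroup (Fin N) ℂ))}
    (hμ : μ ∈ ymGibbsMeasures (fundamentalRep (Fin N)) β) (x : Site d) (a : Fin d) (w : Word d)
    (hw : TiltedRP.Word.endpoint (TiltedRP.zdUnit d) x w = x) (xs : ι → Site d) (vs : ι → Word d) :
    (∑ k ∈ Finset.range w.length, ∫ U, TiltedRP.splitTerm (fundamentalRep (Fin N)) (TiltedRP.zdUnit d) 1 x a U w k *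
        (∏ c, (fundamentalRep (Fin N) (TiltedRP.wordHolonomy (TiltedRP.zdUnit d) U (xs c) (vs c))).trace) ∂μ) +
      (∑ c, ∑ k ∈ Finset.range (vs c).length,
        ∫ U, (∏ b ∈ Finset.univ.erase c, (fundamentalRep (Fin N) (TiltedRP.wordHolonomy (TiltedRP.zdUnit d) U (xs b) (vs b))).trace) *
          TiltedRP.mergeTerm (fundamentalRep (Fin N)) (TiltedRP.zdUnit d) 1 x a U w (xs c) (vs c) k ∂μ) +
      (β / 2 : ℂ) * ∑ ν ∈ Finset.univ.erase a, ∑ ε : Bool,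
        ∫ U, TiltedRP.plaqTerm (fundamentalRep (Fin N)) (TiltedRP.zdUnit d) 1 x a U w ν ε *
          (∏ c, (fundamentalRep (Fin N) (TiltedRP.wordHolonomy (TiltedRP.zdUnit d) U (xs c) (vs c))).trace) ∂μ = 0 := by
  haveI : SecondCountableTopology (Matrix (Fin N) (Fin N) ℂ) :=
    inferInstanceAs (SecondCountableTopology (Fin N → Fin N → ℂ))
  haveI : SecondCountableTopology (Matrix.specialUnitaryGroup (Fin N) ℂ) :=
    Topology.IsEmbedding.subtypeVal.secondCountableTopology
  have hG : IsGibbsMeasure (ymSpecification (fundamentalRep (Fin N)) β) μ := hμ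
  haveI := hG.isProbabilityMeasure
  exact (isHaarShiftState_of_mem_ymGibbsMeasures (fundamentalRep (Fin N)) (continuous_fundamentalRep (Fin N))
    hμ).loopEquationMany_suN x a w hw xs vs

/-- ★★★ **… and every infinite-volume limit point of the torus Wilson states** (`SU(N)`, every real `β`). [folklore] -/
theorem loopEquationMany_suN_of_mem_infiniteVolumeLimitPoints {β : ℝ}
    {μ : Measure (LGConfig d (Matrix.specialUnitaryGroup (Fin N) ℂ))}
    (hμ : μ ∈ infiniteVolumeLimitPoints (d := d) (fundamentalRep (Fin N)) β) (x : Site d) (a : Fin d) (w : Word d)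
    (hw : TiltedRP.Word.endpoint (TiltedRP.zdUnit d) x w = x) (xs : ι → Site d) (vs : ι → Word d) :
    (∑ k ∈ Finset.range w.length, ∫ U, TiltedRP.splitTerm (fundamentalRep (Fin N)) (TiltedRP.zdUnit d) 1 x a U w k *
        (∏ c, (fundamentalRep (Fin N) (TiltedRP.wordHolonomy (TiltedRP.zdUnit d) U (xs c) (vs c))).trace) ∂μ) +
      (∑ c, ∑ k ∈ Finset.range (vs c).length,
        ∫ U, (∏ b ∈ Finset.univ.erase c, (fundamentalRep (Fin N) (TiltedRP.wordHolonomy (TiltedRP.zdUnit d) U (xs b) (vs b))).trace) *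
          TiltedRP.mergeTerm (fundamentalRep (Fin N)) (TiltedRP.zdUnit d) 1 x a U w (xs c) (vs c) k ∂μ) +
      (β / 2 : ℂ) * ∑ ν ∈ Finset.univ.erase a, ∑ ε : Bool,
        ∫ U, TiltedRP.plaqTerm (fundamentalRep (Fin N)) (TiltedRP.zdUnit d) 1 x a U w ν ε *
          (∏ c, (fundamentalRep (Fin N) (TiltedRP.wordHolonomy (TiltedRP.zdUnit d) U (xs c) (vs c))).trace) ∂μ = 0 := by
  haveI : SecondCountableTopology (Matrix (Fin N) (Fin N) ℂ) :=
    inferInstanceAs (SecondCountableTopology (Fin N → Fin N → ℂ))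
  haveI : SecondCountableTopology (Matrix.specialUnitaryGroup (Fin N) ℂ) :=
    Topology.IsEmbedding.subtypeVal.secondCountableTopology
  exact loopEquationMany_suN_of_mem_ymGibbsMeasures
    (mem_ymGibbsMeasures_of_mem_infiniteVolumeLimitPoints_holds (fundamentalRep (Fin N))
      (continuous_fundamentalRep (Fin N)) hμ) x a w hw xs vs

/-- ★★★ **EVERY `U(N)` HAAR-SHIFT STATE ON `ℤ^d` SATISFIES EVERY MULTI-TRACE LOOP EQUATION** (`s = 0`: no `1/N`
terms). [folklore] -/
theorem IsHaarShiftState.loopEquationMany_uN {β : ℝ}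
    {μ : Measure (LGConfig d (Matrix.unitaryGroup (Fin N) ℂ))} [IsFiniteMeasure μ]
    (hμ : IsHaarShiftState (unitaryFundamentalRep (Fin N) ℂ) β μ) (x : Site d) (a : Fin d) (w : Word d)
    (hw : TiltedRP.Word.endpoint (TiltedRP.zdUnit d) x w = x) (xs : ι → Site d) (vs : ι → Word d) :
    (∑ k ∈ Finset.range w.length, ∫ U, TiltedRP.splitTerm (unitaryFundamentalRep (Fin N) ℂ) (TiltedRP.zdUnit d) 0 x a U w k *
        (∏ c, (unitaryFundamentalRep (Fin N) ℂ (TiltedRP.wordHolonomy (TiltedRP.zdUnit d) U (xs c) (vs c))).trace) ∂μ) +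
      (∑ c, ∑ k ∈ Finset.range (vs c).length,
        ∫ U, (∏ b ∈ Finset.univ.erase c, (unitaryFundamentalRep (Fin N) ℂ (TiltedRP.wordHolonomy (TiltedRP.zdUnit d) U (xs b) (vs b))).trace) *
          TiltedRP.mergeTerm (unitaryFundamentalRep (Fin N) ℂ) (TiltedRP.zdUnit d) 0 x a U w (xs c) (vs c) k ∂μ) +
      (β / 2 : ℂ) * ∑ ν ∈ Finset.univ.erase a, ∑ ε : Bool,
        ∫ U, TiltedRP.plaqTerm (unitaryFundamentalRep (Fin N) ℂ) (TiltedRP.zdUnit d) 0 x a U w ν ε *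
          (∏ c, (unitaryFundamentalRep (Fin N) ℂ (TiltedRP.wordHolonomy (TiltedRP.zdUnit d) U (xs c) (vs c))).trace) ∂μ = 0 :=
  TiltedRP.loopEquationZdMany_of_sdPairMany μ (unitaryFundamentalLatticeRep N) β x a 0 w hw xs vs fun _ _ =>
    TiltedRP.sdPairManyZd_unitaryGroup N hμ x a x w xs vs _

/-- ★★★ **EVERY DLR STATE OF `U(N)` LATTICE YANG–MILLS ON `ℤ^d` SATISFIES EVERY MULTI-TRACE LOOP EQUATION.** [folklore] -/
theorem loopEquationMany_uN_of_mem_ymGibbsMeasures {β : ℝ}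
    {μ : Measure (LGConfig d (Matrix.unitaryGroup (Fin N) ℂ))}
    (hμ : μ ∈ ymGibbsMeasures (unitaryFundamentalRep (Fin N) ℂ) β) (x : Site d) (a : Fin d) (w : Word d)
    (hw : TiltedRP.Word.endpoint (TiltedRP.zdUnit d) x w = x) (xs : ι → Site d) (vs : ι → Word d) :
    (∑ k ∈ Finset.range w.length, ∫ U, TiltedRP.splitTerm (unitaryFundamentalRep (Fin N) ℂ) (TiltedRP.zdUnit d) 0 x a U w k *
        (∏ c, (unitaryFundamentalRep (Fin N) ℂ (TiltedRP.wordHolonomy (TiltedRP.zdUnit d) U (xs c) (vs c))).trace) ∂μ) +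
      (∑ c, ∑ k ∈ Finset.range (vs c).length,
        ∫ U, (∏ b ∈ Finset.univ.erase c, (unitaryFundamentalRep (Fin N) ℂ (TiltedRP.wordHolonomy (TiltedRP.zdUnit d) U (xs b) (vs b))).trace) *
          TiltedRP.mergeTerm (unitaryFundamentalRep (Fin N) ℂ) (TiltedRP.zdUnit d) 0 x a U w (xs c) (vs c) k ∂μ) +
      (β / 2 : ℂ) * ∑ ν ∈ Finset.univ.erase a, ∑ ε : Bool,
        ∫ U, TiltedRP.plaqTerm (unitaryFundamentalRep (Fin N) ℂ) (TiltedRP.zdUnit d) 0 x a U w ν ε *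
          (∏ c, (unitaryFundamentalRep (Fin N) ℂ (TiltedRP.wordHolonomy (TiltedRP.zdUnit d) U (xs c) (vs c))).trace) ∂μ = 0 := by
  haveI : SecondCountableTopology (Matrix (Fin N) (Fin N) ℂ) :=
    inferInstanceAs (SecondCountableTopology (Fin N → Fin N → ℂ))
  haveI : SecondCountableTopology (Matrix.unitaryGroup (Fin N) ℂ) :=
    Topology.IsEmbedding.subtypeVal.secondCountableTopology
  have hG : IsGibbsMeasure (ymSpecification (unitaryFundamentalRep (Fin N) ℂ) β) μ := hμ
  haveI := hG.isProbabilityMeasure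
  exact (isHaarShiftState_of_mem_ymGibbsMeasures (unitaryFundamentalRep (Fin N) ℂ) (continuous_unitaryFundamentalRep (Fin N) ℂ)
    hμ).loopEquationMany_uN x a w hw xs vs

end States

end Summit.QuantumFields.GaugeBoot

end
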